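import Literature.Computability.QuantumComplexity.UncomputeBranches
import Literature.Computability.QuantumComplexity.HybridArgument
import HarnessLib

/-!
# Measuring after a classical reversible stage: the Born law is pushed forward along the label map

Topic `Literature/Computability/QuantumComplexity`; sequel of `UncomputeBranches.lean` (`IsBasisMap M κ`:
the matrix `M` sends `|z⟩` to `|κ z⟩`) and `Cryptography/QuantumCircuit.lean` (`bornPMF`, the law of a
full computational-basis measurement). A classical reversible circuit (a basis map along an injective,
hence bijective, relabelling `κ` of the finite label set) applied right before the final measurement
merely relabels the outcomes (Nielsen–Chuang 2010, §1.4.1 / §3.2.5: reversible classical computation on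
basis states; §2.2.5: the Born rule):

* `IsBasisMap.mulVec_apply_self` — `(M v)(κ z) = v(z)`; `IsBasisMap.normSq_mulVec` — `M` preserves
  `normSq`;
* **`IsBasisMap.bornPMF_mulVec`** — `Born(M v) = κ_* Born(v)` for a unit vector `v`.

This is the post-processing step of Regev's sampler (J. ACM 56 (2009), Lemma 3.14: after the Fourier
stage the residues are read and decoded classically — in a uniform circuit family the decoding is a
reversible classical stage before the measurement, and the output law is the push-forward of the law
bounded in `Cryptography/RegevSamplerMachine.lean`).

Everything is proved; no definition, no named fact is introduced.

## References

* M. A. Nielsen, I. L. Chuang, *Quantum Computation and Quantum Information*, CUP 2010, §1.4.1,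
  §2.2.5, §3.2.5 [NielsenChuang2010].
* O. Regev, *On lattices, learning with errors, random linear codes, and cryptography*, J. ACM 56
  (2009), art. 34, Lemma 3.14 (proof) [Regev2009].
-/

noncomputable section

open Matrix Finset

namespace Literature.Computability.QuantumComplexity

open Cryptography

variable {W : ℕ} {M : Matrix (QReg W) (QReg W) ℂ} {κ : QReg W → QReg W}

/-- **A basis map moves the amplitude of `z` to `κ z`.** [cite: NielsenChuang2010, §1.4.1] -/
theorem IsBasisMap.mulVec_apply_self (h : IsBasisMap M κ) (hκ : Function.Injective κ) (v : QReg W → ℂ) (z : QReg W) :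
    (M *ᵥ v) (κ z) = v z := by
  classical
  rw [h.mulVec_eq_sum, Finset.sum_apply, sum_eq_single z]
  · rw [Pi.smul_apply, basisState_apply, if_pos rfl, smul_eq_mul, mul_one]
  · intro z' _ hz'
    rw [Pi.smul_apply, basisState_apply, if_neg (fun e => hz' (hκ e.symm)), smul_zero]
  · exact fun hz => absurd (mem_univ z) hz

/-- Outside the image the amplitude vanishes. [folklore] -/
theorem IsBasisMap.mulVec_apply_of_not_mem_range (h : IsBasisMap M κ) (v : QReg W → ℂ) {y : QReg W}
    (hy : y ∉ Set.range κ) : (M *ᵥ v) y = 0 := by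
  classical
  rw [h.mulVec_eq_sum, Finset.sum_apply]
  refine sum_eq_zero fun z _ => ?_
  rw [Pi.smul_apply, basisState_apply, if_neg (fun e => hy ⟨z, e.symm⟩), smul_zero]

/-- **A basis map along an injective relabelling preserves `normSq`.** [cite: NielsenChuang2010, §1.4.1] -/
theorem IsBasisMap.normSq_mulVec (h : IsBasisMap M κ) (hκ : Function.Injective κ) (v : QReg W → ℂ) :
    normSq (M *ᵥ v) = normSq v := by
  have hbij : Function.Bijective κ := Finite.injective_iff_bijective.1 hκ
  unfold normSq
  rw [← (Equiv.ofBijective κ hbij).sum_comp]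
  refine sum_congr rfl fun z _ => ?_
  rw [Equiv.ofBijective_apply, h.mulVec_apply_self hκ]

/-- **Measuring after a classical reversible stage**: for a unit vector `v` and a basis map `M` along an
injective `κ`, the Born law of `M v` is the push-forward of the Born law of `v` along `κ`.
[cite: NielsenChuang2010, §2.2.5, §3.2.5] [cite: Regev2009, Lemma 3.14 (proof)] -/
theorem IsBasisMap.bornPMF_mulVec (h : IsBasisMap M κ) (hκ : Function.Injective κ) {v : QReg W → ℂ}
    (hv : normSq v = 1) : bornPMF (M *ᵥ v) = (bornPMF v).map κ := by
  classical
  have hbij : Function.Bijective κ := Finite.injective_iff_bijective.1 hκ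
  have hMv : normSq (M *ᵥ v) = 1 := by rw [h.normSq_mulVec hκ, hv]
  refine PMF.ext fun y => ?_
  obtain ⟨z, rfl⟩ := hbij.2 y
  rw [bornPMF_apply_of_sum_eq_one hMv, h.mulVec_apply_self hκ, PMF.map_apply, tsum_eq_single z,
    if_pos rfl, bornPMF_apply_of_sum_eq_one hv]
  intro z' hz'
  rw [if_neg (fun e => hz' (hκ e).symm)]

end Literature.Computability.QuantumComplexity

end
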